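import Summits.QuantumFields.YangMills.Theorems.UnitScaleTiltProp7KatoBootstrapMember
import Literature.MathematicalPhysics.QuantumFieldTheory.Balaban1983to89.B9Eq342SupNormBootstrapWeightedChain
import Literature.MathematicalPhysics.QuantumFieldTheory.Balaban1983to89.B5Eq129FreeResolventDecayedLetterSiteDiag
import HarnessLib

/-!
# Route `UnitScaleTilt`, crux K1 «MinimiserStabilityRegPr» (stmt-QuantumFields-19200), EX face after S45 — **(L3′b)-VALUE FILE V3: THE DECAY EDITION OF
# THE KATO BOOTSTRAP AT THE T³ MEMBER** — the WEIGHTED (Agmon) bootstrap with three Kato dominations, instantiated at `L := Δ^η_{U₀} = covLapSite F n K c₀ U₀`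
# exactly as V1 ✓`Prop7KatoBootstrapMember` instantiates the unweighted one, with the decayed free letter (D-FS) DISCHARGED at the diagonal (level-free):
# for EVERY background `U₀`, every penalty (abstract, inside `q`), every supersolution weight `W` of the flat `ℓ²`-stencil (`λW ≤ (L₀ + 1)W`, `W(x₀) = 1`) and
# data dominated by the weight (`‖f(y)‖ + ‖q(y)‖ ≤ s·λ·W(y)`):
#   `‖u(x₀)‖ ≤ s·(1 + λ⁻¹ + λ⁻²) + √(27∕(c₀ℓ³λ³))·√(Σ_y c₀‖u(y)‖²∕W(y))`,  `ℓ = L^{K−n}`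
# (★p1 g25 2026-08-30 04:41Z «w5: V3 GO, PARALLEL»; ★★OWNER RULING №35-A (b); chair's V2 = the penalty∕energy letters of `G_a`; V4 = the 10-line meeting)

Cell `ym3-torus` (HUMAN RULING D-0037; rung R3 = SU(2) YM₃ on T³ — NOT d = 4, NOT infinite volume, NOT a mass gap, NOT Clay).  Width seat `ym-ust-19200-w5` (gen 14).
THEOREMS ONLY (0 `def`, 0 `sorry`, default heartbeats); `--supports stmt-QuantumFields-19200 --as helper`; count-neutral.

WHY.  V1's ★`norm_apply_le_of_kato_member` is print's (3.42) first entry WITHOUT the factor `e^{−δ₀d(y,y′)}`; the ten post-S45 print rows (`h133`, `h88`, `h137kπ`,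
`h137kΔ`, `hCk`, `h349`, …) are POINTWISE DECAY kernels, so the engine they need is the bootstrap read against an Agmon weight.  That engine is ABSTRACT in the tree
(pub-balaban NE9 sup-norm programme, storey (D)): lit ✓`B9Eq342SupNormBootstrapWeightedChain.norm_le_of_kato_bootstrap_weighted_chain_centre` — Kato domination
([DodziukMathai2006]) `k` times along a resolvent chain `φ₀ = ‖u‖, (L₀+m)φ_{j+1} = φ_j`, the data chain bounded against the supersolution by the weighted maximum
principle lit ✓`scalar_le_mul_of_supersolution`: `‖u(x₀)‖ ≤ s·Σ_{l<k}(m∕λ)^l + m^k·φ_k(x₀)`; and the free value `φ_k(x₀)` is the DECAYED FREE LETTER (D-FS), in the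
tree on EVERY torus `TSite d P` for EVERY supersolution weight with a LEVEL-FREE constant at the diagonal: lit ✓`B5Eq129FreeResolventDecayedLetterSiteDiag.chain_apply_le_weighted_site_diag`
(`k ≥ d`, `0 < t ≤ P_ν`, `c₀t^d = c₁`: `φ_k(x₀) ≤ √(3^d∕c₁·λ^{−k}·W(x₀))·√(Σ_y c₀φ₀(y)²∕W(y))`).  THIS FILE composes the two at the member: `ι := TSite 3 (periodsT3 F K)`,
`J := Fin 3 ⊕ Fin 3`, `nbr := Sum.elim unshift shift`, weights `ℓ²` (`ℓ = η⁻¹ = L^{K−n}`), transporters `R(U₀)⁻¹ ⊕ R(U₀)` (Frobenius ISOMETRIES, V1 ✓`norm_adBg_eq`∕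
✓`norm_adBgInv_eq`), Kato form by lit ✓`equiv_covLaplaceSiteK_eq_sum` through ✓`covLapSite_eq` (`rfl`), `k := 3 = d`, `m := 1`, `c₁ := c₀ℓ³`, `hvol` = V1 ✓`eta_inv_le_periods`.
WHAT IS PROVED (ns `Summit.QuantumFields.YangMills.Theorems.Prop7KatoBootstrapMemberDecay`).
* ★★★ `norm_apply_le_of_kato_member_weighted` — FOR EVERY `U₀` (no `RegPr`, no window), every `u f q` with `Δ^η_{U₀}u = f − q`, every weight `W > 0` with `W(x₀) = 1`
  and `λW ≤ (L₀+1)W` (`0 < λ`; the flat `ℓ²`-stencil in the `Sum.elim unshift shift` graph form), every `s ≥ 0` with `‖f(y)‖ + ‖q(y)‖ ≤ s·λ·W(y)`: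
  `‖u(x₀)‖ ≤ s·Σ_{l<3}(1∕λ)^l + √(3³∕(c₀ℓ³)·(λ³)⁻¹)·√(Σ_y c₀‖u(y)‖²∕W(y))` — the WEIGHT IS ABSTRACT (so V4 may take the `cosh` weight of lit ✓`B9Eq342CoshWeightSite`
  (`weight_site_pos`∕`_centre`∕`_supersolution`, `λ = 1 − 2d·ℓ²(cosh a − 1)`, ✓`exists_rate`: `λ ≥ 1∕2`) or any other supersolution), the PENALTY IS ABSTRACT (inside `q`).
* ★★ `norm_apply_le_of_kato_member_weighted_of_letter` — the same with the (D-E) slot displayed as ONE letter `hEW : √(Σ_y c₀‖u(y)‖²∕W(y)) ≤ E_W`: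
  `‖u(x₀)‖ ≤ s·Σ_{l<3}(1∕λ)^l + √(3³∕(c₀ℓ³)·(λ³)⁻¹)·E_W` — the shape V4 feeds (block support of `f` against the weight ⟹ `s = O(F·e^{−a·d(x₀,v)})`; px5's (L3′a) block
  decay of `G_a` + the weight's block-distance domination ⟹ `E_W`), landing on lit ✓`B9Eq342GreenPrimeSupBoundDecay.norm_GpOfU_apply_le_decay`'s two-rate shape
  `(B₁e^{−κ′d} + B₂e^{−(κ′∕2)d})·F`.
* `sum_range_three_inv` — bookkeeping: `Σ_{l<3}(1∕λ)^l = 1 + λ⁻¹ + λ⁻²`.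
HONEST SCOPE.  A composition of lit engines at the member's letters; CONDITIONAL on the displayed letters (weight, data domination, and — in the second theorem — `E_W`);
nothing of the ten rows, `hT`, `hGF`, (3.42)∕Thm 3.1 for print's operators, EX `stub_existenceMinimalOrbit` or the crux is proved here; the Yang–Mills mass gap is NOT proved.

References: T. Bałaban, CMP **99** (1985) 389–434 [Balaban1985BackgroundPropagators] (Thm 3.1 (3.42) p.397 with its factor `e^{−δ₀d(y,y′)}`, (3.23)–(3.25) p.394, (3.11) p.392,
(3.39) p.397); J. Dodziuk, V. Mathai, Contemp. Math. **398** (2006) [DodziukMathai2006] (§1 Lemma 1.1, Thm 1.5); CMP **95** (1984) 17–40 [Balaban1984PropagatorsI]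
((1.29)∕(1.31) p.23, Prop. 1.1 p.33, p.36 — the Agmon weight).
-/

set_option autoImplicit false

noncomputable section

open scoped InnerProductSpace ComplexConjugate BigOperators

namespace Summit.QuantumFields.YangMills.Theorems.Prop7KatoBootstrapMemberDecay

open Literature.MathematicalPhysics.QuantumFieldTheory.Balaban1983to89
open Literature.MathematicalPhysics.QuantumFieldTheory.Balaban1983to89.T3ContinuumYM3Torus
open B4Sect5Torus (TSite)
open B9SectCLatticeCarrier (Bond shift unshift)
open B9Eq311L2Pairing (WL2)
open B11Eq103H1Complex (SiteL2K covLaplaceSiteK)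
open B9Eq323KatoDomination (equiv_covLaplaceSiteK_eq_sum)
open B9Eq342SupNormBootstrapWeightedChain (exists_scalar_chain norm_le_of_kato_bootstrap_weighted_chain_centre)
open B5Eq129FreeResolventDecayedLetterSiteDiag (chain_apply_le_weighted_site_diag)
open T3SectALandauChart (eta eta_pos)
open Summit.QuantumFields.YangMills.Theorems.Prop7SectET3Transport (periodsT3)
open Summit.QuantumFields.YangMills.Theorems.Prop7SectET3HilbertLetters (W₂ adBg adBgInv covLapSite covLapSite_eq)
open Summit.QuantumFields.YangMills.Theorems.Prop7KatoBootstrapMember (norm_adBg_eq norm_adBgInv_eq adBgInv_adBg eta_inv_le_periods norm_eq_sqrt_sum_T3)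

variable (F : T3Family) (n K : ℕ) (c₀ : ℝ) [Fact (0 < c₀)]

/-- Bookkeeping: `Σ_{l<3}(1∕λ)^l = 1 + λ⁻¹ + λ⁻²`. [folklore] -/
theorem sum_range_three_inv (lam : ℝ) : ∑ l ∈ Finset.range 3, (1 / lam) ^ l = 1 + lam⁻¹ + lam⁻¹ ^ 2 := by
  simp [Finset.sum_range_succ, one_div]

/-- ★★★ **THE WEIGHTED KATO BOOTSTRAP (DECAY EDITION) AT THE T³ MEMBER, FOR EVERY BACKGROUND, EVERY PENALTY AND EVERY SUPERSOLUTION WEIGHT.**  Let `U₀` be ANY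
configuration of the finest lattice of the member `(F, n ≤ K)`, `u f q ∈ L²(c₀)` with `Δ^η_{U₀}u = f − q` (so `(Δ^η_{U₀} + P)u = f` for any `P` with `Pu = q`), `W > 0` a weight
on the fine sites with `W(x₀) = 1` and `λ·W ≤ (L₀ + 1)W` for the flat `ℓ²`-stencil `(L₀W)(y) = Σ_{j : Fin 3 ⊕ Fin 3} ℓ²(W(y) − W(nbr(y,j)))`, `nbr = Sum.elim unshift shift`
(`0 < λ`), and suppose the data are dominated by the weight: `‖f(y)‖ + ‖q(y)‖ ≤ s·λ·W(y)` (`0 ≤ s`).  Then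
`‖u(x₀)‖ ≤ s·Σ_{l<3}(1∕λ)^l + √(3³∕(c₀·(L^{K−n})³)·(λ³)⁻¹)·√(Σ_y c₀‖u(y)‖²∕W(y))`.
Lit ✓`norm_le_of_kato_bootstrap_weighted_chain_centre` (`k := 3`, `m := 1`, transporters `R(U₀)⁻¹ ⊕ R(U₀)` isometries) with the chain of lit ✓`exists_scalar_chain` and its free
value bounded by lit ✓`chain_apply_le_weighted_site_diag` at the diagonal `c₁ = c₀ℓ³` (level-free).  CONDITIONAL on the displayed weight and data letters.
[cite: Balaban1985BackgroundPropagators, Thm 3.1 (3.42) p.397, (3.23)–(3.25) p.394, (3.11) p.392; Balaban1984PropagatorsI, (1.29) p.23, Prop. 1.1 p.33, p.36] -/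
theorem norm_apply_le_of_kato_member_weighted (hnK : n ≤ K) (U₀ : GaugeField (F.P K) 0 (Matrix.specialUnitaryGroup (Fin 2) ℂ))
    {u f q : SiteL2K ℂ 3 (periodsT3 F K) c₀ W₂} (hu : covLapSite F n K c₀ U₀ u = f - q)
    {W : TSite 3 (periodsT3 F K) → ℝ} {lam : ℝ} (hlam : 0 < lam) (hW : ∀ y, 0 < W y)
    (hsup : ∀ y, lam * W y ≤ ∑ j : Fin 3 ⊕ Fin 3, (eta F n K)⁻¹ ^ 2 * (W y - W (Sum.elim (fun ν => unshift ν y) (fun ν => shift ν y) j)) + 1 * W y)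
    {s : ℝ} (hs : 0 ≤ s) (hdata : ∀ y, ‖WL2.equiv ℂ _ W₂ f y‖ + ‖WL2.equiv ℂ _ W₂ q y‖ ≤ s * (lam * W y))
    {x₀ : TSite 3 (periodsT3 F K)} (hx₀ : W x₀ = 1) :
    ‖WL2.equiv ℂ _ W₂ u x₀‖ ≤ s * ∑ l ∈ Finset.range 3, (1 / lam) ^ l
        + Real.sqrt (3 ^ 3 / (c₀ * ((F.L : ℝ) ^ (K - n)) ^ 3) * (lam ^ 3)⁻¹) * Real.sqrt (∑ y, c₀ * ‖WL2.equiv ℂ _ W₂ u y‖ ^ 2 / W y) := by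
  have hc₀ : 0 < c₀ := Fact.out
  -- the difference quotient `t = η⁻¹ = ℓ`
  set t : ℝ := (eta F n K)⁻¹ with ht_def
  have ht : 0 < t := inv_pos.mpr (eta_pos F n K)
  have htL : t = (F.L : ℝ) ^ (K - n) := by rw [ht_def, eta, inv_pow, inv_inv]
  -- `Δ^η_{U₀}` IS lit's `covLaplaceSiteK` with the REAL quotient `t`
  have hcast : (((eta F n K : ℝ) : ℂ))⁻¹ = (RCLike.ofReal t : ℂ) := by rw [ht_def]; exact (Complex.ofReal_inv _).symm
  have hsplit : covLaplaceSiteK (RCLike.ofReal t : ℂ) (adBg F K U₀) (adBgInv F K U₀) u = f - q := by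
    have h0 : covLapSite F n K c₀ U₀ = covLaplaceSiteK (RCLike.ofReal t : ℂ) (adBg F K U₀) (adBgInv F K U₀) := by
      rw [covLapSite_eq, hcast]
    rw [← h0]; exact hu
  -- abstract data of the bootstrap (as in V1)
  let nbr : TSite 3 (periodsT3 F K) → Fin 3 ⊕ Fin 3 → TSite 3 (periodsT3 F K) :=
    fun y j => Sum.elim (fun μ => unshift μ y) (fun μ => shift μ y) j
  let T : TSite 3 (periodsT3 F K) → Fin 3 ⊕ Fin 3 → W₂ →ₗ[ℂ] W₂ :=
    fun y j => Sum.elim (fun μ => adBgInv F K U₀ (unshift μ y, μ)) (fun μ => adBg F K U₀ (y, μ)) j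
  have hT : ∀ y j v, ‖T y j v‖ ≤ ‖v‖ := fun y j v => by
    rcases j with μ | μ
    · exact (norm_adBgInv_eq F K U₀ _ v).le
    · exact (norm_adBg_eq F K U₀ _ v).le
  have hu' : ∀ y, ∑ j, (RCLike.ofReal (t ^ 2) : ℂ) • (WL2.equiv ℂ _ W₂ u y - T y j (WL2.equiv ℂ _ W₂ u (nbr y j))) =
      WL2.equiv ℂ _ W₂ f y - WL2.equiv ℂ _ W₂ q y := by
    intro y
    have h := congr_arg (fun g => WL2.equiv ℂ _ W₂ g y) hsplit
    simp only [WL2.equiv_sub, Pi.sub_apply] at h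
    rw [equiv_covLaplaceSiteK_eq_sum t _ _ (adBgInv_adBg F K U₀) u y] at h
    rw [← h, Fintype.sum_sum_type, ← Finset.sum_add_distrib]
    refine Finset.sum_congr rfl fun μ _ => ?_
    rw [← smul_add]; rfl
  -- the supersolution and the data in the bootstrap's currency (`w y j = t²`, `m = 1`)
  have hw : ∀ (y : TSite 3 (periodsT3 F K)) (j : Fin 3 ⊕ Fin 3), (0 : ℝ) ≤ t ^ 2 := fun _ _ => sq_nonneg _
  have hsup' : ∀ y, lam * W y ≤ ∑ j, t ^ 2 * (W y - W (nbr y j)) + 1 * W y := fun y => hsup y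
  -- the 3-chain `φ₀ = ‖u‖`, `(L₀ + 1)φ_{j+1} = φ_j`
  obtain ⟨φ, hφ0, hφ⟩ := exists_scalar_chain nbr (fun _ _ => t ^ 2) hw one_pos (fun y => ‖WL2.equiv ℂ _ W₂ u y‖) 3
  have hφ0' : ∀ y, φ 0 y = ‖WL2.equiv ℂ _ W₂ u y‖ := fun y => by rw [hφ0]
  -- THE WEIGHTED BOOTSTRAP (three dominations)
  have hboot := norm_le_of_kato_bootstrap_weighted_chain_centre (𝕜 := ℂ) nbr (fun _ _ => t ^ 2) hw T hT one_pos hlam hsup' hu' hs hdata hφ0' hφ hx₀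
  -- THE DECAYED FREE LETTER at the diagonal (`k = d = 3`, `c₁ = c₀t³`, level-free)
  have hvol : ∀ ν, t ≤ ((periodsT3 F K ν : ℕ) : ℝ) := fun ν => eta_inv_le_periods F n K hnK ν
  have hfree := chain_apply_le_weighted_site_diag (periodsT3 F K) (d := 3) (k := 3) le_rfl ht hc₀ (c₁ := c₀ * t ^ 3) rfl hvol hlam hW hsup' hφ x₀
  rw [hx₀, mul_one] at hfree
  simp only [hφ0'] at hfree
  -- assemble
  have h1 : (1 : ℝ) ^ 3 * φ 3 x₀ = φ 3 x₀ := by rw [one_pow, one_mul]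
  rw [h1] at hboot
  rw [htL] at hfree
  calc ‖WL2.equiv ℂ _ W₂ u x₀‖ ≤ s * ∑ l ∈ Finset.range 3, (1 / lam) ^ l + φ 3 x₀ := hboot
    _ ≤ s * ∑ l ∈ Finset.range 3, (1 / lam) ^ l
        + Real.sqrt (3 ^ 3 / (c₀ * ((F.L : ℝ) ^ (K - n)) ^ 3) * (lam ^ 3)⁻¹) * Real.sqrt (∑ y, c₀ * ‖WL2.equiv ℂ _ W₂ u y‖ ^ 2 / W y) :=
        add_le_add_right hfree _

/-- ★★ **THE DECAY EDITION WITH THE (D-E) SLOT AS ONE LETTER.**  Same data; if moreover the weighted `L²` size of `u` against `1∕W` is bounded, `√(Σ_y c₀‖u(y)‖²∕W(y)) ≤ E_W`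
(the letter V4 feeds from the `L²` BLOCK DECAY of the solution operator — px5 g11's (L3′a) rows for `G_a` — and the weight's block-distance domination, lit
✓`B9Eq342CoshWeightSite.exp_blockDist_le_weight_site`-class), then
`‖u(x₀)‖ ≤ s·Σ_{l<3}(1∕λ)^l + √(3³∕(c₀·(L^{K−n})³)·(λ³)⁻¹)·E_W` — the two-rate shape of lit ✓`B9Eq342GreenPrimeSupBoundDecay.norm_GpOfU_apply_le_decay` once `s` and `E_W` carry
`e^{−a·d(x₀, supp f)}`.  CONDITIONAL on the displayed letters. [cite: Balaban1985BackgroundPropagators, Thm 3.1 (3.42) p.397, (3.11) p.392; Balaban1984PropagatorsI, Prop. 1.1 p.33, p.36] -/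
theorem norm_apply_le_of_kato_member_weighted_of_letter (hnK : n ≤ K) (U₀ : GaugeField (F.P K) 0 (Matrix.specialUnitaryGroup (Fin 2) ℂ))
    {u f q : SiteL2K ℂ 3 (periodsT3 F K) c₀ W₂} (hu : covLapSite F n K c₀ U₀ u = f - q)
    {W : TSite 3 (periodsT3 F K) → ℝ} {lam : ℝ} (hlam : 0 < lam) (hW : ∀ y, 0 < W y)
    (hsup : ∀ y, lam * W y ≤ ∑ j : Fin 3 ⊕ Fin 3, (eta F n K)⁻¹ ^ 2 * (W y - W (Sum.elim (fun ν => unshift ν y) (fun ν => shift ν y) j)) + 1 * W y)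
    {s : ℝ} (hs : 0 ≤ s) (hdata : ∀ y, ‖WL2.equiv ℂ _ W₂ f y‖ + ‖WL2.equiv ℂ _ W₂ q y‖ ≤ s * (lam * W y))
    {x₀ : TSite 3 (periodsT3 F K)} (hx₀ : W x₀ = 1)
    {EW : ℝ} (hEW : Real.sqrt (∑ y, c₀ * ‖WL2.equiv ℂ _ W₂ u y‖ ^ 2 / W y) ≤ EW) :
    ‖WL2.equiv ℂ _ W₂ u x₀‖ ≤ s * ∑ l ∈ Finset.range 3, (1 / lam) ^ l + Real.sqrt (3 ^ 3 / (c₀ * ((F.L : ℝ) ^ (K - n)) ^ 3) * (lam ^ 3)⁻¹) * EW := by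
  have h := norm_apply_le_of_kato_member_weighted F n K c₀ hnK U₀ hu hlam hW hsup hs hdata hx₀
  exact h.trans (add_le_add_right (mul_le_mul_of_nonneg_left hEW (Real.sqrt_nonneg _)) _)

end Summit.QuantumFields.YangMills.Theorems.Prop7KatoBootstrapMemberDecay

end
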